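import Summits.NavierStokesRegularity.NavierStokesRegularity.Theorems.SoloSalvageShahmurov2026b
import Literature.Analysis.FluidPDE.PeriodicPressureNormalisation
import Literature.Analysis.FluidPDE.NSLerayHopf
import Literature.Analysis.FluidPDE.TaoClassGlobal
import Literature.Analysis.FluidPDE.ClassicalSolutionTorusProofs
import Literature.Analysis.FunctionSpaces.FlatTorusProofs
import Literature.Analysis.FunctionSpaces.TorusClassicalNSUniqueness
import Literature.Analysis.FunctionSpaces.TorusHolderBridge
import HarnessLib

/-!
# C12 `Shahmurov2026b` — salvage, part 2: the typed Clay delta is a theorem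

Cell `ns-claims` (D-0090 NS-CLAIMS SWEEP), salvage seat `ns-claims-salvage-p5`; continuation of
`Theorems/SoloSalvageShahmurov2026b.lean` (400-line cap). The skeleton
`Literature/Claims/NS/Shahmurov2026b.lean` (typist-8, p464917) isolates the EXACT extra hypothesis under
which the claimed Theorem 2.1 yields Clay's printed (D): `ClayDelta = ContinuationBridge ∧
PeriodScalingBridge`. The period half was discharged in part 1 (`periodScalingBridge_holds`, via lit-4's
`ClayPeriodScalingBridge`). This file discharges the continuation half and hence the whole delta:

* `torus_descend_classical` — a classical solution on `ℝ³ × S` with `ℤ³`-periodic velocity and pressure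
  slices descends to a classical solution on `𝕋³ × S` (`IsClassicalNSSolutionOn.to_torus_holds` after
  `congr_slices` / `lift_descend`);
* `torus_eq_on_Ico` — classical uniqueness on `[0,T₁)` on the torus (Majda–Bertozzi Cor. 3.1 on each
  `[0,t]`, tree `Torus.IsClassicalNSSolutionOn.velocity_unique`);
* `exists_norm_fderiv_lift_le` — a global classical solution on `𝕋³` has `‖∇u‖` bounded on
  `[0,T] × ℝ³`;
* `continuationBridge_holds : ContinuationBridge` — a periodic-pressure classical solution on `[0,T*)`
  with `∫₀^{T*}‖∇u‖_∞ = ∞` from `u₀` excludes every global smooth solution of the printed class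
  (velocity `2π`-periodic, pressure free) from `u₀`: Leray rescaling to period `1` (same `ν`), Galilean
  renormalisation of the pressure fixing the datum (Tao 2013 Lemma 4.1 (ii); lit-4's
  `IsNavierStokesSolution.exists_pressurePeriodic_of_velocityPeriodic_zero`), descent, uniqueness, and
  `‖∇u(t)‖_∞ = (2π)⁻²‖∇u₁(t/(2π)²)‖_∞ ≤ (2π)⁻²D`;
* `clayDelta_holds : ClayDelta`, `clayD_of_claimed : ClaimedTheorem → NavierStokesBreakdownPeriodic` —
  the claimed theorem decides Clay (D) AS PRINTED with no delta (MAP Clay cell: «(D) printed; composes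
  YES»).

WHAT THIS IS NOT: not a claim about NS regularity or blow-up; not a claim about any author beyond
the typed locator.
-/

noncomputable section

open Metric Set Filter MeasureTheory Function
open scoped Topology ENNReal ContDiff

-- The mandated landing namespace repeats the summit name by design (D-0017).
set_option linter.dupNamespace false

namespace Summit.NavierStokesRegularity.NavierStokesRegularity.Theorems

namespace Shahmurov2026b

open Literature.Claims.NS.Shahmurov2026b Literature.Analysis Literature.Analysis.FluidPDE
  Literature.Analysis.FunctionSpaces

section ContinuationBridge

/-- **Descent of a space-periodic classical solution to the flat torus.** A classical solution of the
unforced Navier–Stokes system on `ℝ³ × S` whose velocity and pressure slices are `ℤ³`-periodic for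
`t ∈ S` is, read through `Torus.repr`, a classical solution on `𝕋³ × S`, and its slices are the lifts
of the descended ones. [folklore] -/
theorem torus_descend_classical {S : Set ℝ} {ν : ℝ}
    {u : ℝ → EuclideanSpace ℝ (Fin 3) → EuclideanSpace ℝ (Fin 3)} {p : ℝ → EuclideanSpace ℝ (Fin 3) → ℝ}
    (hcl : FluidPDE.IsClassicalNSSolutionOn S ν 0 u p)
    (hper : ∀ t ∈ S, IsLatticePeriodic (u t) ∧ IsLatticePeriodic (p t)) :
    Torus.IsClassicalNSSolutionOn S ν 0 (fun t x => u t (Torus.repr x)) (fun t x => p t (Torus.repr x)) ∧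
      ∀ t ∈ S, Torus.lift (fun x => u t (Torus.repr x)) = u t := by
  have hvU : ∀ t ∈ S, (fun s => Torus.lift (fun x => u s (Torus.repr x))) t = u t := fun t ht =>
    Torus.lift_descend_holds (u t) (hper t ht).1
  have hqP : ∀ t ∈ S, (fun s => Torus.lift (fun x => p s (Torus.repr x))) t = p t := fun t ht =>
    Torus.lift_descend_holds (p t) (hper t ht).2
  have hcl' : FluidPDE.IsClassicalNSSolutionOn S ν
      (fun t => Torus.lift ((0 : ℝ → UnitAddTorus (Fin 3) → EuclideanSpace ℝ (Fin 3)) t))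
      (fun t => Torus.lift (fun x => u t (Torus.repr x))) (fun t => Torus.lift (fun x => p t (Torus.repr x))) := by
    have h0 : (fun t => Torus.lift ((0 : ℝ → UnitAddTorus (Fin 3) → EuclideanSpace ℝ (Fin 3)) t)) =
        (0 : ℝ → EuclideanSpace ℝ (Fin 3) → EuclideanSpace ℝ (Fin 3)) := rfl
    rw [h0]
    exact hcl.congr_slices hvU hqP
  exact ⟨IsClassicalNSSolutionOn.to_torus_holds hcl', hvU⟩

/-- **Uniqueness on a half-open interval of regularity, on the torus**: a classical solution on
`𝕋³ × [0,T₁)` and a global one with the same datum agree on `[0,T₁)` (Majda–Bertozzi Cor. 3.1 on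
each `[0,t]`, tree `Torus.IsClassicalNSSolutionOn.velocity_unique`). [folklore] -/
theorem torus_eq_on_Ico {ν : ℝ} (hν : 0 ≤ ν) {T₁ : ℝ}
    {U₁ U₂ : ℝ → UnitAddTorus (Fin 3) → EuclideanSpace ℝ (Fin 3)} {P₁ P₂ : ℝ → UnitAddTorus (Fin 3) → ℝ}
    (h₁ : Torus.IsClassicalNSSolutionOn (Ico 0 T₁) ν 0 U₁ P₁)
    (h₂ : Torus.IsClassicalNSSolutionOn (Ici 0) ν 0 U₂ P₂) (h0 : U₁ 0 = U₂ 0) :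
    ∀ t ∈ Ico 0 T₁, U₁ t = U₂ t := by
  intro t ht
  rcases eq_or_lt_of_le ht.1 with h | h
  · rw [← h]; exact h0
  have h₁' := h₁.mono (Icc_subset_Ico_right ht.2) (uniqueDiffOn_Icc h)
  have h₂' := h₂.mono (Icc_subset_Ici_self) (uniqueDiffOn_Icc h)
  exact Torus.IsClassicalNSSolutionOn.velocity_unique hν h₁' h₂' h0 ⟨h.le, le_rfl⟩

/-- **The velocity gradient of a global classical solution on the torus is bounded on `[0,T] × ℝ³`**
(read on the periodic lift): `‖D(lift U(t))(y)‖ ≤ D` for `t ∈ [0,T]`. [folklore] -/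
theorem exists_norm_fderiv_lift_le {ν : ℝ} {U : ℝ → UnitAddTorus (Fin 3) → EuclideanSpace ℝ (Fin 3)}
    {P : ℝ → UnitAddTorus (Fin 3) → ℝ} (h : Torus.IsClassicalNSSolutionOn (Ici 0) ν 0 U P) (T : ℝ) :
    ∃ D : ℝ, ∀ t ∈ Icc 0 T, ∀ y : EuclideanSpace ℝ (Fin 3), ‖fderiv ℝ (Torus.lift (U t)) y‖ ≤ D := by
  have hS : UniqueDiffOn ℝ (Ici (0 : ℝ)) := uniqueDiffOn_Ici 0
  have hb : ∀ i : Fin 3, ∃ C : ℝ, ∀ t ∈ Icc 0 T, ∀ x, ‖Torus.partialDeriv i (U t) x‖ ≤ C := fun i =>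
    (h.smooth_velocity.partialDeriv hS i).exists_norm_le_of_isCompact isCompact_Icc Icc_subset_Ici_self
  choose C hC using hb
  refine ⟨∑ i, C i, fun t ht y => ?_⟩
  have hUt : Torus.IsSmooth (U t) := h.smooth_velocity.isSmooth_slice (Icc_subset_Ici_self ht)
  exact Torus.norm_fderiv_lift_le_of_norm_partialDeriv_le (hUt.isContDiff (n := 1) (by simp))
    (fun i x => hC i t ht x) y

/-- **The continuation half of the typed Clay delta is a THEOREM**: a periodic-pressure classical
solution on `[0,T*)` with `∫₀^{T*}‖∇u‖_∞ = ∞` from `u₀` excludes every global smooth solution of the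
printed class (velocity `2π`-periodic, pressure unconstrained) from the same datum. Proof (all
ingredients in the tree): rescale both to period `1` (Leray scaling `nsRescale (2π)`, same `ν`;
`IsClassicalNSSolutionOn.nsRescale_holds`, `ClayVariants.isNavierStokesSolution_nsRescale_zero`);
renormalise the pressure of the global solution by a Galilean boost fixing the datum (Tao 2013
Lemma 4.1 (ii); lit-4's `IsNavierStokesSolution.exists_pressurePeriodic_of_velocityPeriodic_zero`);
descend both to `𝕋³` (`torus_descend_classical`) and compare by classical uniqueness
(`torus_eq_on_Ico`); the global solution has a bounded gradient on `[0,T₁] × ℝ³`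
(`exists_norm_fderiv_lift_le`), and `‖∇u(t)‖_∞ = (2π)⁻²‖∇u₁(t/(2π)²)‖_∞`, so the blow-up integral is
finite — contradiction. [cite: Shahmurov2026b, Thm 2.1 p.2 and Thm 13.2 p.10] [cite: Tao2013Localisation, Prop. 1.7 and Lemma 4.1 (ii)] -/
theorem continuationBridge_holds : ContinuationBridge := by
  intro ν hν u₀ T hT hblow hglob
  obtain ⟨u, p, hcl, hu0, hper, htop⟩ := hblow
  obtain ⟨v, q, hvs, hqs, hns, hvper⟩ := hglob
  have hL0 : 0 < 2 * Real.pi := Real.two_pi_pos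
  set L : ℝ := 2 * Real.pi with hL
  have hL2 : 0 < L ^ 2 := pow_pos hL0 2
  -- (1) the blow-up solution rescaled to period 1, on `[0, T₁)`, `T₁ = T/L²`
  set T₁ : ℝ := T / L ^ 2 with hT₁
  have hpre : (fun t : ℝ => L ^ 2 * t) ⁻¹' Ico 0 T = Ico 0 T₁ := by
    ext t
    simp only [mem_preimage, mem_Ico, hT₁]
    rw [lt_div_iff₀ hL2, mul_comm t]
    constructor
    · rintro ⟨h1, h2⟩
      exact ⟨(mul_nonneg_iff_of_pos_left hL2).1 h1, h2⟩
    · rintro ⟨h1, h2⟩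
      exact ⟨mul_nonneg hL2.le h1, h2⟩
  have hcl₁ : FluidPDE.IsClassicalNSSolutionOn (Ico 0 T₁) ν 0 (nsRescale L u) (nsRescalePressure L p) := by
    have h := IsClassicalNSSolutionOn.nsRescale_holds hcl hL0
    rwa [hpre, nsRescaleForce_zero] at h
  have hper₁ : ∀ t ∈ Ico 0 T₁,
      IsLatticePeriodic (nsRescale L u t) ∧ IsLatticePeriodic (nsRescalePressure L p t) := by
    intro t ht
    have ht' : t ∈ (fun s : ℝ => L ^ 2 * s) ⁻¹' Ico 0 T := by rw [hpre]; exact ht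
    obtain ⟨hu_per, hp_per⟩ := hper (L ^ 2 * t) ht'
    refine ⟨?_, ?_⟩
    · exact Literature.Claims.NS.ClayVariants.isLatticePeriodic_smul_comp_smul hu_per L
    · have h : nsRescalePressure L p t = fun x => L ^ 2 • p (L ^ 2 * t) (L • x) := by
        funext x; simp [smul_eq_mul]
      rw [h]
      exact Literature.Claims.NS.ClayVariants.isLatticePeriodic_smul_comp_smul hp_per (L ^ 2)
  -- (2) the global printed-class solution, rescaled to period 1 and pressure-normalised
  have hg := Literature.Claims.NS.ClayVariants.isNavierStokesSolution_nsRescale_zero hns hvs hqs hL0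
  have hvper₁ : ∀ t : ℝ, 0 ≤ t → IsLatticePeriodic (nsRescale L v t) := by
    intro t ht
    exact Literature.Claims.NS.ClayVariants.isLatticePeriodic_smul_comp_smul
      (hvper (L ^ 2 * t) (by positivity)) L
  obtain ⟨w, r, hws, hrs, hnsw, hwper⟩ :=
    hg.1.exists_pressurePeriodic_of_velocityPeriodic_zero hg.2.1 hg.2.2 hvper₁
  have hclw : FluidPDE.IsClassicalNSSolutionOn (Ici 0) ν 0 w r :=
    (isNavierStokesSolution_and_smooth_iff.1 ⟨hnsw, hws, hrs⟩).1
  -- (3) descend both to the torus and compare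
  obtain ⟨hU₁, hlift₁⟩ := torus_descend_classical hcl₁ hper₁
  obtain ⟨hU₂, -⟩ := torus_descend_classical hclw fun t ht => hwper t ht
  have h0 : (fun (t : ℝ) (x : UnitAddTorus (Fin 3)) => nsRescale L u t (Torus.repr x)) 0 =
      (fun (t : ℝ) (x : UnitAddTorus (Fin 3)) => w t (Torus.repr x)) 0 := by
    funext x
    show nsRescale L u 0 (Torus.repr x) = w 0 (Torus.repr x)
    rw [nsRescale_zero_time, hu0, hnsw.initial]
  have heq := torus_eq_on_Ico hν.le hU₁ hU₂ h0
  -- (4) the rescaled blow-up solution has a bounded gradient on `[0, T₁)`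
  obtain ⟨D, hD⟩ := exists_norm_fderiv_lift_le hU₂ T₁
  have hgrad₁ : ∀ s ∈ Ico 0 T₁, ∀ y, ‖fderiv ℝ (nsRescale L u s) y‖ ≤ D := by
    intro s hs y
    rw [← hlift₁ s hs, heq s hs]
    exact hD s (Ico_subset_Icc_self hs) y
  -- (5) undo the scaling: `u(t) = L⁻¹ u₁(t/L²)(L⁻¹ ·)`
  have hunscale : ∀ t, u t = fun y => L⁻¹ • nsRescale L u (t / L ^ 2) (L⁻¹ • y) := by
    intro t; funext y
    have h1 : L ^ 2 * (t / L ^ 2) = t := by field_simp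
    have h2 : L • (L⁻¹ • y) = y := by rw [smul_smul, mul_inv_cancel₀ hL0.ne', one_smul]
    rw [nsRescale_apply, h1, h2, smul_smul, inv_mul_cancel₀ hL0.ne', one_smul]
  have hfd : ∀ t ∈ Ioo 0 T, ∀ x, ‖fderiv ℝ (u t) x‖ ≤ L⁻¹ * L⁻¹ * D := by
    intro t ht x
    have hs : t / L ^ 2 ∈ Ico 0 T₁ :=
      ⟨div_nonneg ht.1.le hL2.le, div_lt_div_of_pos_right ht.2 hL2⟩
    rw [hunscale t, fderiv_const_smul_comp_smul_apply, norm_smul, Real.norm_eq_abs,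
      abs_of_pos (mul_pos (inv_pos.2 hL0) (inv_pos.2 hL0))]
    exact mul_le_mul_of_nonneg_left (hgrad₁ _ hs (L⁻¹ • x)) (by positivity)
  -- (6) hence the blow-up integral is finite: contradiction
  have hfin : (∫⁻ t in Ioo 0 T, ⨆ x : EuclideanSpace ℝ (Fin 3), ‖fderiv ℝ (u t) x‖ₑ) < ⊤ := by
    have hle : ∀ t ∈ Ioo 0 T, (⨆ x : EuclideanSpace ℝ (Fin 3), ‖fderiv ℝ (u t) x‖ₑ) ≤
        ENNReal.ofReal (L⁻¹ * L⁻¹ * D) := fun t ht =>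
      iSup_le fun x => by
        rw [← ofReal_norm]
        exact ENNReal.ofReal_le_ofReal (hfd t ht x)
    calc (∫⁻ t in Ioo 0 T, ⨆ x : EuclideanSpace ℝ (Fin 3), ‖fderiv ℝ (u t) x‖ₑ)
        ≤ ∫⁻ _ in Ioo 0 T, ENNReal.ofReal (L⁻¹ * L⁻¹ * D) := setLIntegral_mono measurable_const hle
      _ = ENNReal.ofReal (L⁻¹ * L⁻¹ * D) * volume (Ioo 0 T) := setLIntegral_const _ _
      _ < ⊤ := ENNReal.mul_lt_top ENNReal.ofReal_lt_top (by simp [Real.volume_Ioo])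
  exact hfin.ne htop

/-- **The typed Clay delta of C12 is a theorem**: `ClayDelta = ContinuationBridge ∧ PeriodScalingBridge`,
both halves discharged (`continuationBridge_holds`, `periodScalingBridge_holds`). Hence
`ClaimedTheorem → Clay (D) printed` unconditionally (`clayD_of_claimed`). [cite: Shahmurov2026b, Thm 2.1 p.2] -/
theorem clayDelta_holds : ClayDelta := ⟨continuationBridge_holds, periodScalingBridge_holds⟩

/-- **`ClaimedTheorem → Clay (D) as printed`, unconditionally** (the skeleton's
`clay_of_claimed_of_delta` with the delta discharged, then `ClayVariants.clayPeriodic_breakdown_iff`):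
the MAP's Clay cell for C12 has no Δ left. [cite: Shahmurov2026b, Thm 2.1 p.2] [cite: FeffermanClay2006, statement (D) p.2] -/
theorem clayD_of_claimed (h : ClaimedTheorem) :
    Summit.NavierStokesRegularity.NavierStokesRegularity.NavierStokesBreakdownPeriodic :=
  Literature.Claims.NS.ClayVariants.clayPeriodic_breakdown_iff.mp (clay_of_claimed_of_delta clayDelta_holds h)

end ContinuationBridge

end Shahmurov2026b

end Summit.NavierStokesRegularity.NavierStokesRegularity.Theorems

end
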